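import Summits.CriticalPhenomena.PercolationContinuityZ3.Theorems.PercNearOneGluingNoHeavyConstsClusterSquareApicesGap
import HarnessLib

/-!
# Outerplanar graph plus independent apices: the graphs of the class, and two apices never separate each other

builds on p205010 (kernel theorem, internal audit signed; external expert review pending)

PAPER-2 track "percolation constants", part (ii), seat `prim-consts-1`, gen 22 (lane index
`run/shared/lean/prim/consts/CONSTANTS.md`, row A19; memo `FROM-prim-consts-1-g22-CROSS-LINKAGE.md` §2).
Support file for the crux `NoHeavyLowerTail` (stmt-CriticalPhenomena-4575; `--supports`).  Theorems only; no definitions, no sorries.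

* `Consts.Apices.exists_graphs`: the rim graph `G₀`, contracted graphs `Hp S` and chord graphs `C x` of the class (I)(R)(F)(L)(L2) of
  `…ConstsClusterSquareApices.lean` with all their non-crossing properties, for every cut point (packaging of the construction inside
  `Consts.Apices.unlinked`).
* `Consts.Apices.sep_recut`: a separation statement "cut open at `γ`: `t` strictly before `δ`, `t'` strictly after" read in the order
  cut open at another rim vertex (`omega` after `NonCrossing.val_sub_eq`).
* `Consts.Apices.not_sep_sep`: for three distinct apices `h₁, h₂, h₃`, a chord `{α, β}` of `h₁` strictly separating a neighbour of
  `h₂` from a neighbour of `h₃` and a chord `{γ, δ}` of `h₂` strictly separating a neighbour of `h₁` from a neighbour of `h₃` cannot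
  coexist: (L) confines `γ, δ` to one side of `{α, β}`, then the `h₁`-end of the second separation interleaves, or the two apices share
  `α, β` and a third neighbour ((L2)) or interleave there, or the two `h₃`-neighbours straddle `{α, β}` ((L)).  Consequence
  (`…ConstsClusterSquareApicesAllTriples.lean`): of three apices at most one is a bad root, so TS holds for every all-apex triple.
Census (lane engines g22 `eng/t1_check.py`, `eng/t2_brute.py`): never two separating roots in one triple (three apices, ≤ 5 rim
vertices: 0 of 409 984 triples); the separation lemma brute-forced on cycles of length ≤ 8 with all coincidence patterns (3 913 728
configurations, 0 violations).
References: N. Gladkov, arXiv:2408.08457v2 (2024), Def. 4.2, Thm. 4.3; G. Chartrand, F. Harary, Ann. Inst. H. Poincaré B 3 (1967)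
433–438 (outerplanar graphs).
-/

noncomputable section

open Classical

namespace Summit.CriticalPhenomena.PercolationContinuityZ3.Theorems

open MeasureTheory Finset Literature.Probability.LatticeModels Literature.Probability.Percolation

namespace Consts

namespace Apices

variable {n m : ℕ} {pos : Fin n → Fin m} {hub : Fin n → Prop}

/-! ### The graphs of the class -/

/-- THE GRAPHS OF THE CLASS: from (R), (F), (L) the rim graph `G₀` (rim edges), the contracted graphs `Hp S` (rim edges and chords of the
apices in `S`) and the chord graphs `C x`, with: no `Hp S`-edge crosses a `G₀`-edge, no `Hp S`-edge crosses a `C x`-chord for `x ∉ S`, no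
two chords of distinct apices cross — in the order cut open at any vertex `a`. [folklore] -/
theorem exists_graphs (H : SimpleGraph (Fin n)) (hub : Fin n → Prop) (pos : Fin n → Fin m)
    (hR : ∀ p q r s : Fin n, ¬ hub p → ¬ hub q → ¬ hub r → ¬ hub s → H.Adj p q → H.Adj r s →
      pos p < pos r → pos r < pos q → pos q < pos s → False)
    (hF : ∀ x p q u v : Fin n, hub x → ¬ hub p → ¬ hub q → H.Adj p q → H.Adj x u → H.Adj x v →
      pos p < pos u → pos u < pos q → (pos q < pos v ∨ pos v < pos p) → False)
    (hL : ∀ x x' u v u' v' : Fin n, hub x → hub x' → x ≠ x' → H.Adj x u → H.Adj x v → H.Adj x' u' → H.Adj x' v' →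
      pos u < pos u' → pos u' < pos v → pos v < pos v' → False) :
    ∃ (G₀ : SimpleGraph (Fin n)) (Hp : Set (Fin n) → SimpleGraph (Fin n)) (C : Fin n → SimpleGraph (Fin n)),
      (∀ u v, H.Adj u v → ¬ hub u → ¬ hub v → G₀.Adj u v) ∧
      (∀ S u v, H.Adj u v → ¬ hub u → ¬ hub v → (Hp S).Adj u v) ∧
      (∀ (S : Set (Fin n)) x u v, hub x → x ∈ S → u ≠ v → ¬ hub u → ¬ hub v → H.Adj x u → H.Adj x v → (Hp S).Adj u v) ∧
      (∀ x u v, hub x → u ≠ v → ¬ hub u → ¬ hub v → H.Adj x u → H.Adj x v → (C x).Adj u v) ∧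
      ∀ a : Fin n,
        (∀ (S : Set (Fin n)) p q r s, (Hp S).Adj p q → G₀.Adj r s → (pos p - pos a).val < (pos r - pos a).val →
          (pos r - pos a).val < (pos q - pos a).val → (pos q - pos a).val < (pos s - pos a).val → False) ∧
        (∀ (S : Set (Fin n)) p q r s, G₀.Adj p q → (Hp S).Adj r s → (pos p - pos a).val < (pos r - pos a).val →
          (pos r - pos a).val < (pos q - pos a).val → (pos q - pos a).val < (pos s - pos a).val → False) ∧
        (∀ (S : Set (Fin n)) x p q r s, hub x → x ∉ S → (Hp S).Adj p q → (C x).Adj r s →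
          (pos p - pos a).val < (pos r - pos a).val → (pos r - pos a).val < (pos q - pos a).val →
          (pos q - pos a).val < (pos s - pos a).val → False) ∧
        (∀ (S : Set (Fin n)) x p q r s, hub x → x ∉ S → (C x).Adj p q → (Hp S).Adj r s →
          (pos p - pos a).val < (pos r - pos a).val → (pos r - pos a).val < (pos q - pos a).val →
          (pos q - pos a).val < (pos s - pos a).val → False) ∧
        (∀ x x' p q r s, hub x → hub x' → x ≠ x' → (C x).Adj p q → (C x').Adj r s →
          (pos p - pos a).val < (pos r - pos a).val → (pos r - pos a).val < (pos q - pos a).val →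
          (pos q - pos a).val < (pos s - pos a).val → False) := by
  let G₀ : SimpleGraph (Fin n) := SimpleGraph.fromRel fun u v => H.Adj u v ∧ ¬ hub u ∧ ¬ hub v
  let Hp : Set (Fin n) → SimpleGraph (Fin n) := fun S => SimpleGraph.fromRel fun u v =>
    ¬ hub u ∧ ¬ hub v ∧ (H.Adj u v ∨ ∃ x, hub x ∧ x ∈ S ∧ H.Adj x u ∧ H.Adj x v)
  let C : Fin n → SimpleGraph (Fin n) := fun x => SimpleGraph.fromRel fun u v => ¬ hub u ∧ ¬ hub v ∧ H.Adj x u ∧ H.Adj x v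
  have hG₀ : ∀ u v, G₀.Adj u v → H.Adj u v ∧ ¬ hub u ∧ ¬ hub v := by
    intro u v huv
    rcases (SimpleGraph.fromRel_adj _ u v).1 huv with ⟨_, ⟨e, hu, hv⟩ | ⟨e, hv, hu⟩⟩
    · exact ⟨e, hu, hv⟩
    · exact ⟨e.symm, hu, hv⟩
  have hHp : ∀ S u v, (Hp S).Adj u v → ¬ hub u ∧ ¬ hub v ∧ (H.Adj u v ∨ ∃ x, hub x ∧ x ∈ S ∧ H.Adj x u ∧ H.Adj x v) := by
    intro S u v huv
    rcases (SimpleGraph.fromRel_adj _ u v).1 huv with ⟨_, ⟨hu, hv, e⟩ | ⟨hv, hu, e⟩⟩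
    · exact ⟨hu, hv, e⟩
    · rcases e with e | ⟨x, hx, hxS, e1, e2⟩
      · exact ⟨hu, hv, Or.inl e.symm⟩
      · exact ⟨hu, hv, Or.inr ⟨x, hx, hxS, e2, e1⟩⟩
  have hC : ∀ x u v, (C x).Adj u v → ¬ hub u ∧ ¬ hub v ∧ H.Adj x u ∧ H.Adj x v := by
    intro x u v huv
    rcases (SimpleGraph.fromRel_adj _ u v).1 huv with ⟨_, ⟨hu, hv, e1, e2⟩ | ⟨hv, hu, e2, e1⟩⟩
    · exact ⟨hu, hv, e1, e2⟩
    · exact ⟨hu, hv, e1, e2⟩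
  have y0 : ∀ (S : Set (Fin n)) p q r s, (Hp S).Adj p q → G₀.Adj r s →
      pos p < pos r → pos r < pos q → pos q < pos s → False := by
    intro S p q r s hpq hrs l1 l2 l3
    obtain ⟨hp, hq, e⟩ := hHp S p q hpq
    obtain ⟨ers, hr, hs⟩ := hG₀ r s hrs
    rcases e with e | ⟨x, hx, -, e1, e2⟩
    · exact hR p q r s hp hq hr hs e ers l1 l2 l3
    · exact hF x r s q p hx hr hs ers e2 e1 l2 l3 (Or.inr l1)
  have y0' : ∀ (S : Set (Fin n)) p q r s, G₀.Adj p q → (Hp S).Adj r s →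
      pos p < pos r → pos r < pos q → pos q < pos s → False := by
    intro S p q r s hpq hrs l1 l2 l3
    obtain ⟨epq, hp, hq⟩ := hG₀ p q hpq
    obtain ⟨hr, hs, e⟩ := hHp S r s hrs
    rcases e with e | ⟨x, hx, -, e1, e2⟩
    · exact hR p q r s hp hq hr hs epq e l1 l2 l3
    · exact hF x p q r s hx hp hq epq e1 e2 l1 l2 (Or.inl l3)
  have yC : ∀ (S : Set (Fin n)) x p q r s, hub x → x ∉ S → (Hp S).Adj p q → (C x).Adj r s →
      pos p < pos r → pos r < pos q → pos q < pos s → False := by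
    intro S x p q r s hx hxS hpq hrs l1 l2 l3
    obtain ⟨hp, hq, e⟩ := hHp S p q hpq
    obtain ⟨_, _, f1, f2⟩ := hC x r s hrs
    rcases e with e | ⟨x', hx', hx'S, e1, e2⟩
    · exact hF x p q r s hx hp hq e f1 f2 l1 l2 (Or.inl l3)
    · exact hL x' x p q r s hx' hx (fun h => hxS (h ▸ hx'S)) e1 e2 f1 f2 l1 l2 l3
  have yC' : ∀ (S : Set (Fin n)) x p q r s, hub x → x ∉ S → (C x).Adj p q → (Hp S).Adj r s →
      pos p < pos r → pos r < pos q → pos q < pos s → False := by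
    intro S x p q r s hx hxS hpq hrs l1 l2 l3
    obtain ⟨_, _, f1, f2⟩ := hC x p q hpq
    obtain ⟨hr, hs, e⟩ := hHp S r s hrs
    rcases e with e | ⟨x', hx', hx'S, e1, e2⟩
    · exact hF x r s q p hx hr hs e f2 f1 l2 l3 (Or.inr l1)
    · exact hL x x' p q r s hx hx' (fun h => hxS (h.symm ▸ hx'S)) f1 f2 e1 e2 l1 l2 l3
  have yCC : ∀ x x' p q r s, hub x → hub x' → x ≠ x' → (C x).Adj p q → (C x').Adj r s →
      pos p < pos r → pos r < pos q → pos q < pos s → False := by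
    intro x x' p q r s hx hx' hxx' hpq hrs l1 l2 l3
    obtain ⟨_, _, e1, e2⟩ := hC x p q hpq
    obtain ⟨_, _, f1, f2⟩ := hC x' r s hrs
    exact hL x x' p q r s hx hx' hxx' e1 e2 f1 f2 l1 l2 l3
  refine ⟨G₀, Hp, C, fun u v e hu hv => (SimpleGraph.fromRel_adj _ u v).2 ⟨e.ne, Or.inl ⟨e, hu, hv⟩⟩,
    fun S u v e hu hv => (SimpleGraph.fromRel_adj _ u v).2 ⟨e.ne, Or.inl ⟨hu, hv, Or.inl e⟩⟩,
    fun S x u v hx hxS huv hu hv e1 e2 => (SimpleGraph.fromRel_adj _ u v).2 ⟨huv, Or.inl ⟨hu, hv, Or.inr ⟨x, hx, hxS, e1, e2⟩⟩⟩,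
    fun x u v _ huv hu hv e1 e2 => (SimpleGraph.fromRel_adj _ u v).2 ⟨huv, Or.inl ⟨hu, hv, e1, e2⟩⟩, fun a => ⟨?_, ?_, ?_, ?_, ?_⟩⟩
  · exact fun S p q r s hpq hrs => Apex.noncross_rot₂ (y0 S) (y0' S) a hpq hrs
  · exact fun S p q r s hpq hrs => Apex.noncross_rot₂ (y0' S) (y0 S) a hpq hrs
  · exact fun S x p q r s hx hxS hpq hrs => Apex.noncross_rot₂ (yC S x · · · · hx hxS) (yC' S x · · · · hx hxS) a hpq hrs
  · exact fun S x p q r s hx hxS hpq hrs => Apex.noncross_rot₂ (yC' S x · · · · hx hxS) (yC S x · · · · hx hxS) a hpq hrs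
  · exact fun x x' p q r s hx hx' hxx' hpq hrs =>
      Apex.noncross_rot₂ (yCC x x' · · · · hx hx' hxx') (yCC x' x · · · · hx' hx hxx'.symm) a hpq hrs

/-! ### Re-cutting a separation statement -/

/-- A separation "cut open at `γ`: `t` strictly before `δ`, `t'` strictly after `δ` (or vice versa)" read in the order cut open at
another vertex `α`: exactly one of `t, t'` lies strictly between `γ` and `δ`, and neither is at `γ` or `δ`. [folklore] -/
theorem sep_recut (α γ : Fin n) {δ t t' : Fin n}
    (h : (0 < (pos t - pos γ).val ∧ (pos t - pos γ).val < (pos δ - pos γ).val ∧ (pos δ - pos γ).val < (pos t' - pos γ).val) ∨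
      (0 < (pos t' - pos γ).val ∧ (pos t' - pos γ).val < (pos δ - pos γ).val ∧ (pos δ - pos γ).val < (pos t - pos γ).val)) :
    ((((pos γ - pos α).val < (pos t - pos α).val ∧ (pos t - pos α).val < (pos δ - pos α).val) ∨
        ((pos δ - pos α).val < (pos t - pos α).val ∧ (pos t - pos α).val < (pos γ - pos α).val)) ∧
      ¬ (((pos γ - pos α).val < (pos t' - pos α).val ∧ (pos t' - pos α).val < (pos δ - pos α).val) ∨
        ((pos δ - pos α).val < (pos t' - pos α).val ∧ (pos t' - pos α).val < (pos γ - pos α).val)) ∨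
     ¬ (((pos γ - pos α).val < (pos t - pos α).val ∧ (pos t - pos α).val < (pos δ - pos α).val) ∨
        ((pos δ - pos α).val < (pos t - pos α).val ∧ (pos t - pos α).val < (pos γ - pos α).val)) ∧
      (((pos γ - pos α).val < (pos t' - pos α).val ∧ (pos t' - pos α).val < (pos δ - pos α).val) ∨
        ((pos δ - pos α).val < (pos t' - pos α).val ∧ (pos t' - pos α).val < (pos γ - pos α).val))) ∧
    (pos t - pos α).val ≠ (pos γ - pos α).val ∧ (pos t - pos α).val ≠ (pos δ - pos α).val ∧
    (pos t' - pos α).val ≠ (pos γ - pos α).val ∧ (pos t' - pos α).val ≠ (pos δ - pos α).val := by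
  have bt := (pos t).isLt; have bt' := (pos t').isLt; have bδ := (pos δ).isLt
  have bγ := (pos γ).isLt; have bα := (pos α).isLt
  simp only [NonCrossing.val_sub_eq] at h ⊢
  split_ifs at h ⊢ <;> omega

section Endgame

variable {H G₀ : SimpleGraph (Fin n)} {Hp : Set (Fin n) → SimpleGraph (Fin n)} {C : Fin n → SimpleGraph (Fin n)} {a : Fin n}
  (hpos : ∀ u v, ¬ hub u → ¬ hub v → pos u = pos v → u = v)
  (hI : ∀ u v, hub u → hub v → ¬ H.Adj u v)
  (g1 : ∀ u v, H.Adj u v → ¬ hub u → ¬ hub v → G₀.Adj u v)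
  (g2 : ∀ S u v, H.Adj u v → ¬ hub u → ¬ hub v → (Hp S).Adj u v)
  (g3 : ∀ (S : Set (Fin n)) x u v, hub x → x ∈ S → u ≠ v → ¬ hub u → ¬ hub v → H.Adj x u → H.Adj x v → (Hp S).Adj u v)
  (c1 : ∀ x u v, hub x → u ≠ v → ¬ hub u → ¬ hub v → H.Adj x u → H.Adj x v → (C x).Adj u v)
  (x0 : ∀ (S : Set (Fin n)) p q r s, (Hp S).Adj p q → G₀.Adj r s → (pos p - pos a).val < (pos r - pos a).val →
    (pos r - pos a).val < (pos q - pos a).val → (pos q - pos a).val < (pos s - pos a).val → False)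
  (x0' : ∀ (S : Set (Fin n)) p q r s, G₀.Adj p q → (Hp S).Adj r s → (pos p - pos a).val < (pos r - pos a).val →
    (pos r - pos a).val < (pos q - pos a).val → (pos q - pos a).val < (pos s - pos a).val → False)
  (xC : ∀ (S : Set (Fin n)) x p q r s, hub x → x ∉ S → (Hp S).Adj p q → (C x).Adj r s →
    (pos p - pos a).val < (pos r - pos a).val → (pos r - pos a).val < (pos q - pos a).val →
    (pos q - pos a).val < (pos s - pos a).val → False)
  (xC' : ∀ (S : Set (Fin n)) x p q r s, hub x → x ∉ S → (C x).Adj p q → (Hp S).Adj r s →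
    (pos p - pos a).val < (pos r - pos a).val → (pos r - pos a).val < (pos q - pos a).val →
    (pos q - pos a).val < (pos s - pos a).val → False)
  (xCC : ∀ x x' p q r s, hub x → hub x' → x ≠ x' → (C x).Adj p q → (C x').Adj r s →
    (pos p - pos a).val < (pos r - pos a).val → (pos r - pos a).val < (pos q - pos a).val →
    (pos q - pos a).val < (pos s - pos a).val → False)
  (ha : ¬ hub a)
include hpos hI g1 g2 g3 c1 x0 x0' xC xC' xCC ha

omit hI g1 g2 g3 x0 x0' xC xC' in
/-- CORE OF THE TWO-APEX SEPARATION LEMMA (orientation `γ < δ`, cut open at `a ∈ N(h₁)`): see `Consts.Apices.not_sep_sep`. [folklore] -/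
theorem not_sep_sep_core (hL2 : ∀ x x' u v w, hub x → hub x' → x ≠ x' → u ≠ v → u ≠ w → v ≠ w →
      H.Adj x u → H.Adj x v → H.Adj x w → H.Adj x' u → H.Adj x' v → H.Adj x' w → False)
    {h₁ h₂ h₃ β t₂ t₃ γ δ t₁ t₃' : Fin n} (hh₁ : hub h₁) (hh₂ : hub h₂) (hh₃ : hub h₃) (h12 : h₁ ≠ h₂) (h13 : h₁ ≠ h₃)
    (hβ : ¬ hub β) (ht₂ : ¬ hub t₂) (ht₃ : ¬ hub t₃) (hγ : ¬ hub γ) (hδ : ¬ hub δ) (ht₁ : ¬ hub t₁)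
    (ht₃' : ¬ hub t₃')
    (e1a : H.Adj h₁ a) (e1β : H.Adj h₁ β) (e1t : H.Adj h₁ t₁) (e2t : H.Adj h₂ t₂) (e2γ : H.Adj h₂ γ) (e2δ : H.Adj h₂ δ)
    (e3t : H.Adj h₃ t₃) (e3t' : H.Adj h₃ t₃')
    (s1 : (0 < (pos t₂ - pos a).val ∧ (pos t₂ - pos a).val < (pos β - pos a).val ∧
        (pos β - pos a).val < (pos t₃ - pos a).val) ∨
      (0 < (pos t₃ - pos a).val ∧ (pos t₃ - pos a).val < (pos β - pos a).val ∧ (pos β - pos a).val < (pos t₂ - pos a).val))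
    (s2 : ((pos γ - pos a).val < (pos t₁ - pos a).val ∧ (pos t₁ - pos a).val < (pos δ - pos a).val ∧
        ¬ ((pos γ - pos a).val < (pos t₃' - pos a).val ∧ (pos t₃' - pos a).val < (pos δ - pos a).val)) ∨
      (¬ ((pos γ - pos a).val < (pos t₁ - pos a).val ∧ (pos t₁ - pos a).val < (pos δ - pos a).val) ∧
        (pos γ - pos a).val < (pos t₃' - pos a).val ∧ (pos t₃' - pos a).val < (pos δ - pos a).val))
    (n1γ : (pos t₁ - pos a).val ≠ (pos γ - pos a).val) (n1δ : (pos t₁ - pos a).val ≠ (pos δ - pos a).val)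
    (n3γ : (pos t₃' - pos a).val ≠ (pos γ - pos a).val) (n3δ : (pos t₃' - pos a).val ≠ (pos δ - pos a).val)
    (hγδ : (pos γ - pos a).val < (pos δ - pos a).val) : False := by
  have P : ∀ u v : Fin n, ¬ hub u → ¬ hub v → u ≠ v → (pos u - pos a).val ≠ (pos v - pos a).val :=
    fun u v hu hv huv e => huv (hpos u v hu hv (NonCrossing.rot_injective (pos a) e))
  have E : ∀ u v : Fin n, ¬ hub u → ¬ hub v → (pos u - pos a).val = (pos v - pos a).val → u = v :=
    fun u v hu hv e => hpos u v hu hv (NonCrossing.rot_injective (pos a) e)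
  have h0 : (pos a - pos a).val = 0 := NonCrossing.rot_self (pos a)
  -- chord builder
  have K : ∀ {x u v : Fin n}, hub x → ¬ hub u → ¬ hub v → H.Adj x u → H.Adj x v →
      (pos u - pos a).val < (pos v - pos a).val → (C x).Adj u v :=
    fun hx hu hv eu ev l => c1 _ _ _ hx (fun e => by rw [e] at l; exact lt_irrefl _ l) hu hv eu ev
  have haβ : (pos a - pos a).val < (pos β - pos a).val := by rw [h0]; rcases s1 with ⟨l1, l2, -⟩ | ⟨l1, l2, -⟩ <;> omega
  have Caβ : (C h₁).Adj a β := K hh₁ ha hβ e1a e1β haβ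
  have Cγδ : (C h₂).Adj γ δ := K hh₂ hγ hδ e2γ e2δ hγδ
  rcases s1 with ⟨l1, l2, l3⟩ | ⟨l1, l2, l3⟩
  · -- orientation 1: t₂ inside (a, β), t₃ beyond β
    -- Step 1: δ ≤ β
    have st1 : ¬ (pos β - pos a).val < (pos δ - pos a).val := fun l =>
      xCC h₁ h₂ a β t₂ δ hh₁ hh₂ h12 Caβ (K hh₂ ht₂ hδ e2t e2δ (by omega)) (by rw [h0]; exact l1) l2 l
    -- Step 2: t₁ is not strictly between γ and δ
    have st2 : ¬ ((pos γ - pos a).val < (pos t₁ - pos a).val ∧ (pos t₁ - pos a).val < (pos δ - pos a).val) := by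
      rintro ⟨m1, m2⟩
      rcases Nat.lt_or_ge ((pos δ - pos a).val) ((pos β - pos a).val) with hlt | hge
      · exact xCC h₂ h₁ γ δ t₁ β hh₂ hh₁ h12.symm Cγδ (K hh₁ ht₁ hβ e1t e1β (m2.trans hlt)) m1 m2 hlt
      · have eδ : (pos δ - pos a).val = (pos β - pos a).val := by omega
        have eδβ : δ = β := E δ β hδ hβ eδ
        rcases Nat.eq_zero_or_pos ((pos γ - pos a).val) with hγ0 | hγp
        · have eγa : γ = a := E γ a hγ ha (hγ0.trans h0.symm)
          -- h₁, h₂ share a and β; third common neighbour or interleaving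
          rcases lt_trichotomy ((pos t₁ - pos a).val) ((pos t₂ - pos a).val) with l | e | l
          · exact xCC h₂ h₁ a t₂ t₁ β hh₂ hh₁ h12.symm (K hh₂ ha ht₂ (eγa ▸ e2γ) e2t (by rw [h0]; exact l1))
              (K hh₁ ht₁ hβ e1t e1β (by omega)) (by rw [h0]; omega) l l2
          · have e12 : t₁ = t₂ := E t₁ t₂ ht₁ ht₂ e
            exact hL2 h₁ h₂ a β t₁ hh₁ hh₂ h12 (fun e => by rw [e] at haβ; exact lt_irrefl _ haβ)
              (fun e => by subst e; omega)
              (fun e => by rw [e, e12] at l2; exact lt_irrefl _ l2) e1a e1β e1t (eγa ▸ e2γ) (eδβ ▸ e2δ) (e12 ▸ e2t)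
          · exact xCC h₁ h₂ a t₁ t₂ β hh₁ hh₂ h12 (K hh₁ ha ht₁ e1a e1t (by rw [h0]; omega))
              (K hh₂ ht₂ hβ e2t (eδβ ▸ e2δ) l2) (by rw [h0]; exact l1) l (by omega)
        · exact xCC h₁ h₂ a t₁ γ δ hh₁ hh₂ h12 (K hh₁ ha ht₁ e1a e1t (by rw [h0]; omega)) Cγδ (by rw [h0]; exact hγp) m1 m2
    -- Step 3: so t₃' is strictly between γ and δ, below β, while t₃ is beyond β
    rcases s2 with ⟨m1, m2, -⟩ | ⟨-, m1, m2⟩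
    · exact st2 ⟨m1, m2⟩
    · exact xCC h₁ h₃ a β t₃' t₃ hh₁ hh₃ h13 Caβ (K hh₃ ht₃' ht₃ e3t' e3t (by omega)) (by rw [h0]; omega) (by omega) l3
  · -- orientation 2: t₃ inside (a, β), t₂ beyond β
    -- Step 1': γ is `a` or beyond β; δ is beyond β
    have st1 : ¬ (0 < (pos γ - pos a).val ∧ (pos γ - pos a).val < (pos β - pos a).val) := fun l =>
      xCC h₁ h₂ a β γ t₂ hh₁ hh₂ h12 Caβ (K hh₂ hγ ht₂ e2γ e2t (by omega)) (by rw [h0]; exact l.1) l.2 l3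
    have st1' : ¬ (0 < (pos δ - pos a).val ∧ (pos δ - pos a).val < (pos β - pos a).val) := fun l =>
      xCC h₁ h₂ a β δ t₂ hh₁ hh₂ h12 Caβ (K hh₂ hδ ht₂ e2δ e2t (by omega)) (by rw [h0]; exact l.1) l.2 l3
    have hδβ : (pos β - pos a).val ≤ (pos δ - pos a).val := by omega
    rcases Nat.eq_zero_or_pos ((pos γ - pos a).val) with hγ0 | hγp
    · have eγa : γ = a := E γ a hγ ha (hγ0.trans h0.symm)
      rcases s2 with ⟨m1, m2, m3⟩ | ⟨m1, m2, m3⟩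
      · -- t₁ inside (a, δ): t₃' is beyond δ ≥ β, t₃ inside (a, β)
        have l : (pos δ - pos a).val < (pos t₃' - pos a).val := by omega
        exact xCC h₁ h₃ a β t₃ t₃' hh₁ hh₃ h13 Caβ (K hh₃ ht₃ ht₃' e3t e3t' (by omega)) (by rw [h0]; exact l1) l2
          (lt_of_le_of_lt hδβ l)
      · -- t₁ beyond δ ≥ β
        have l : (pos δ - pos a).val < (pos t₁ - pos a).val := by omega
        rcases Nat.lt_or_ge ((pos β - pos a).val) ((pos δ - pos a).val) with hlt | hge
        · exact xCC h₂ h₁ a δ β t₁ hh₂ hh₁ h12.symm (K hh₂ ha hδ (eγa ▸ e2γ) e2δ (by rw [h0]; omega)) (K hh₁ hβ ht₁ e1β e1t (hlt.trans l))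
            haβ hlt l
        · have eδβ : δ = β := E δ β hδ hβ (by omega)
          rcases lt_trichotomy ((pos t₁ - pos a).val) ((pos t₂ - pos a).val) with l' | e | l'
          · exact xCC h₁ h₂ a t₁ β t₂ hh₁ hh₂ h12 (K hh₁ ha ht₁ e1a e1t (by rw [h0]; omega)) (K hh₂ hβ ht₂ (eδβ ▸ e2δ) e2t l3)
              haβ (by omega) l'
          · have e12 : t₁ = t₂ := E t₁ t₂ ht₁ ht₂ e
            exact hL2 h₁ h₂ a β t₁ hh₁ hh₂ h12 (fun e => by rw [e] at haβ; exact lt_irrefl _ haβ)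
              (fun e => by subst e; omega) (fun e => by rw [e] at l3; rw [e12] at l3; exact lt_irrefl _ l3)
              e1a e1β e1t (eγa ▸ e2γ) (eδβ ▸ e2δ) (e12 ▸ e2t)
          · exact xCC h₂ h₁ a t₂ β t₁ hh₂ hh₁ h12.symm (K hh₂ ha ht₂ (eγa ▸ e2γ) e2t (by rw [h0]; omega))
              (K hh₁ hβ ht₁ e1β e1t (by omega)) haβ l3 l'
    · -- γ beyond β (≥): t₁ strictly inside (γ, δ) interleaves; else t₃' inside (γ, δ), beyond β, against t₃
      have hγβ : (pos β - pos a).val ≤ (pos γ - pos a).val := by omega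
      rcases s2 with ⟨m1, m2, -⟩ | ⟨-, m1, m2⟩
      · exact xCC h₁ h₂ a t₁ γ δ hh₁ hh₂ h12 (K hh₁ ha ht₁ e1a e1t (by rw [h0]; omega)) Cγδ (by rw [h0]; exact hγp) m1 m2
      · exact xCC h₁ h₃ a β t₃ t₃' hh₁ hh₃ h13 Caβ (K hh₃ ht₃ ht₃' e3t e3t' (by omega)) (by rw [h0]; exact l1) l2
          (lt_of_le_of_lt hγβ m1)

omit hI g1 g2 g3 x0 x0' xC xC' in
/-- **TWO APICES NEVER SEPARATE EACH OTHER.**  Three distinct apices `h₁, h₂, h₃`; cut open at a neighbour `a` of `h₁`.  If a chord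
`{a, β}` of `h₁` strictly separates a neighbour `t₂` of `h₂` from a neighbour `t₃` of `h₃`, then no chord `{γ, δ}` of `h₂` strictly
separates a neighbour `t₁` of `h₁` from a neighbour `t₃'` of `h₃` (the second separation read in the order cut open at `a`:
exactly one of `t₁, t₃'` strictly between `γ` and `δ`).  Only (L) and (L2) are used. [folklore] -/
theorem not_sep_sep (hL2 : ∀ x x' u v w, hub x → hub x' → x ≠ x' → u ≠ v → u ≠ w → v ≠ w →
      H.Adj x u → H.Adj x v → H.Adj x w → H.Adj x' u → H.Adj x' v → H.Adj x' w → False)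
    {h₁ h₂ h₃ β t₂ t₃ γ δ t₁ t₃' : Fin n} (hh₁ : hub h₁) (hh₂ : hub h₂) (hh₃ : hub h₃) (h12 : h₁ ≠ h₂) (h13 : h₁ ≠ h₃)
    (hβ : ¬ hub β) (ht₂ : ¬ hub t₂) (ht₃ : ¬ hub t₃) (hγ : ¬ hub γ) (hδ : ¬ hub δ) (ht₁ : ¬ hub t₁)
    (ht₃' : ¬ hub t₃')
    (e1a : H.Adj h₁ a) (e1β : H.Adj h₁ β) (e1t : H.Adj h₁ t₁) (e2t : H.Adj h₂ t₂) (e2γ : H.Adj h₂ γ) (e2δ : H.Adj h₂ δ)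
    (e3t : H.Adj h₃ t₃) (e3t' : H.Adj h₃ t₃') (hγδ : γ ≠ δ)
    (s1 : (0 < (pos t₂ - pos a).val ∧ (pos t₂ - pos a).val < (pos β - pos a).val ∧
        (pos β - pos a).val < (pos t₃ - pos a).val) ∨
      (0 < (pos t₃ - pos a).val ∧ (pos t₃ - pos a).val < (pos β - pos a).val ∧ (pos β - pos a).val < (pos t₂ - pos a).val))
    (s2 : ((((pos γ - pos a).val < (pos t₁ - pos a).val ∧ (pos t₁ - pos a).val < (pos δ - pos a).val) ∨
          ((pos δ - pos a).val < (pos t₁ - pos a).val ∧ (pos t₁ - pos a).val < (pos γ - pos a).val)) ∧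
        ¬ (((pos γ - pos a).val < (pos t₃' - pos a).val ∧ (pos t₃' - pos a).val < (pos δ - pos a).val) ∨
          ((pos δ - pos a).val < (pos t₃' - pos a).val ∧ (pos t₃' - pos a).val < (pos γ - pos a).val))) ∨
      (¬ (((pos γ - pos a).val < (pos t₁ - pos a).val ∧ (pos t₁ - pos a).val < (pos δ - pos a).val) ∨
          ((pos δ - pos a).val < (pos t₁ - pos a).val ∧ (pos t₁ - pos a).val < (pos γ - pos a).val)) ∧
        (((pos γ - pos a).val < (pos t₃' - pos a).val ∧ (pos t₃' - pos a).val < (pos δ - pos a).val) ∨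
          ((pos δ - pos a).val < (pos t₃' - pos a).val ∧ (pos t₃' - pos a).val < (pos γ - pos a).val))))
    (n1γ : (pos t₁ - pos a).val ≠ (pos γ - pos a).val) (n1δ : (pos t₁ - pos a).val ≠ (pos δ - pos a).val)
    (n3γ : (pos t₃' - pos a).val ≠ (pos γ - pos a).val) (n3δ : (pos t₃' - pos a).val ≠ (pos δ - pos a).val) : False := by
  have dγδ : (pos γ - pos a).val ≠ (pos δ - pos a).val := fun e =>
    hγδ (hpos γ δ hγ hδ (NonCrossing.rot_injective (pos a) e))
  rcases Nat.lt_or_gt_of_ne dγδ with hlt | hgt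
  · refine not_sep_sep_core hpos c1 xCC ha hL2 hh₁ hh₂ hh₃ h12 h13 hβ ht₂ ht₃ hγ hδ ht₁ ht₃' e1a e1β e1t e2t e2γ e2δ
      e3t e3t' s1 ?_ n1γ n1δ n3γ n3δ hlt
    rcases s2 with ⟨m, m'⟩ | ⟨m, m'⟩
    · exact Or.inl ⟨by omega, by omega, fun h => m' (Or.inl h)⟩
    · exact Or.inr ⟨fun h => m (Or.inl h), by omega, by omega⟩
  · refine not_sep_sep_core hpos c1 xCC ha hL2 hh₁ hh₂ hh₃ h12 h13 hβ ht₂ ht₃ hδ hγ ht₁ ht₃' e1a e1β e1t e2t e2δ e2γ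
      e3t e3t' s1 ?_ n1δ n1γ n3δ n3γ hgt
    rcases s2 with ⟨m, m'⟩ | ⟨m, m'⟩
    · exact Or.inl ⟨by omega, by omega, fun h => m' (Or.inr h)⟩
    · exact Or.inr ⟨fun h => m (Or.inr h), by omega, by omega⟩

end Endgame

end Apices

end Consts

end Summit.CriticalPhenomena.PercolationContinuityZ3.Theorems
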